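import Literature.Probability.RandomPlanarGeometry.SAWPulledBridgeGain
import Literature.Probability.RandomPlanarGeometry.SAWBridgeSpanGF
import Literature.Probability.RandomPlanarGeometry.SAWMassNormFirstHit
import Literature.Probability.RandomPlanarGeometry.SAWBridgeReflectionBound
import Mathlib.Algebra.Order.Chebyshev
import HarnessLib

/-!
# An explicit rate for the decay of the mass `m(z) → 0` as `z ↑ z_c` (self-avoiding walk on `ℤ^{d+1}`)

Madras–Slade, *The Self-Avoiding Walk* (1993), Corollary 4.1.15 (p. 86) states the SOFT fact
`lim_{z ↑ z_c} m(z) = 0` (equivalently `G_{z_c}(0,x)` does not decay exponentially); no modulus is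
printed for `d = 2, 3, 4` (for `d ≥ 5` the lace expansion gives `m(z) ≍ (z_c - z)^{1/2}`,
[MadrasSlade1993, Thm 6.1.6]; M–S (1.3.12)–(1.3.14) give only the direction `m(z) ≥ z_c - z`-type
lower bounds via `χ`).  This file proves, for EVERY `d ≥ 1` (walks on `ℤ^{d+1}`), the explicit bound

  `m(z) ≤ log(1 + 2 / log(z/(1 - zμ)))`   for `0 < z < z_c = μ⁻¹` with `z/(1 - zμ) > 1`,

i.e. `m(z) ≤ (2 + o(1)) / log(1/(1 - z/z_c))` as `z ↑ z_c`, using the elementary reflection bound of `SAWBridgeReflectionBound` (`Zd.card_brSpan_sq_le_real`, route R29.2; the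
chain is first proved with it as an explicit hypothesis `hrefl`):  `(b_{N,L})² ≤ (2N+1)^d · c_{2N+1}((2L+1)e₁)` where `b_{N,L}` counts
`N`-step bridges of span `L` (glue a bridge, one `e₁` step and the point reflection of a second bridge
with the same endpoint).  Chain (all in this file, sorry-free):
* `exists_lt_mul_geom_sum` + `Zd.half_log_geom_le_bridgeGFpos` + `Zd.exists_span_lt_brGF`
  (in-tree, `SAWPulledBridgeGain`) + `Zd.brGF_pow_le` ⟹ `exists_goodSpan_linear`: for
  `ε` with `1/(e^ε - 1) < ½ log(z/(1-zμ))` there are `A ≥ 1`, `M₁` with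
  `V_{kM₁}(z; kA) > e^{-εkA}` for all `k ≥ 1` (`V_M(z;L) = Σ_{n≤M} b_{n,L} zⁿ = Zd.brGF`);
* `brGF_sq_le_of_reflectionBound`: `V_M(z;L)² ≤ (M+1)(2M+1)^d z⁻¹ B(z) e^{-m(z)(2L+1)}`
  (Cauchy–Schwarz over lengths, `hrefl` termwise, odd partial sums of `G_z(0,(2L+1)e₁)`,
  and M–S Thm 4.1.3(a) `(4.1.4)` = `Zd.MadrasSlade1993_thm_4_1_3a_holds`);
* `le_of_exp_lt_poly_mul_exp` (linear vs. logarithmic growth) ⟹ `m(z) ≤ ε`; density in `ε`.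
The soft statement itself (the tree fact `Zd.MadrasSlade1993_cor_4_1_15`, M–S Cor. 4.1.15) is discharged AS
PRINTED (Thm 4.1.13/4.1.14 route) in `SAWMassCriticalLimit` (lit-1); no second derivation of it is made
here.  PRINTED STATUS (lit-2 g7 presearch 2026-08-22T07:31:20Z, corpus + galaxy): M–S Cor. 4.1.15 (book p. 86)
proves `m(z) → 0` as `z ↑ z_c` by left-continuity of `M` and a contradiction with bridge divergence
(Cor. 3.1.8), with no rate; an explicit modulus near `z_c = 1/μ`, every `d`, is not in print — it is
the quantitative form of that contradiction (explicit bridge divergence inside the disc, tree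
`Zd.half_log_geom_le_bridgeGFpos`) plus the reflection bound.
[cite: MadrasSlade1993, Corollary 4.1.15 (p. 86); Theorems 4.1.13 (p. 85), 4.1.14 (p. 86);
Lemma 4.1.12 (pp. 84–85); Corollary 3.1.8 (p. 61); Theorem 4.1.3(a) eq. (4.1.4) (pp. 78–80)
(explicit-rate form: not located in print — derived here)]
-/

open Finset

namespace Literature.Probability.RandomPlanarGeometry.SAW.Zd

/-- Existence of the truncation level: if `z` is ADMISSIBLE
(`zμ ≥ 1`, or `zμ < 1` and `E(1 - zμ) < z`, i.e. `E < z/(1-zμ)`), then some finite `M` has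
`E < z Σ_{n ≤ M} (zμ)ⁿ`. 
[cite: MadrasSlade1993, Corollary 3.1.8 p. 61 (the bridge generating function diverges at z_c: a finite truncation level exists)] -/
theorem exists_lt_mul_geom_sum (d : ℕ) {z E : ℝ} (hz : 0 < z) (_hE : 0 < E)
    (hadm : 1 ≤ z * Zd.connectiveConstant (d + 1) ∨
      (z * Zd.connectiveConstant (d + 1) < 1 ∧ E * (1 - z * Zd.connectiveConstant (d + 1)) < z)) :
    ∃ M : ℕ, E < z * ∑ n ∈ Finset.range (M + 1), (z * Zd.connectiveConstant (d + 1)) ^ n := by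
  set μ := Zd.connectiveConstant (d + 1) with hμ
  rcases hadm with h1 | ⟨h1, h2⟩
  · obtain ⟨M, hM⟩ := exists_nat_gt (E / z)
    refine ⟨M, ?_⟩
    have hS : ((M : ℝ) + 1) ≤ ∑ n ∈ Finset.range (M + 1), (z * μ) ^ n := by
      have := Finset.card_nsmul_le_sum (Finset.range (M + 1)) (fun n => (z * μ) ^ n) 1
        (fun n _ => one_le_pow₀ h1)
      simpa using this
    have hEz : E < z * ((M : ℝ) + 1) := by
      rw [div_lt_iff₀ hz] at hM
      nlinarith
    exact lt_of_lt_of_le hEz (mul_le_mul_of_nonneg_left hS hz.le)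
  · have hzμ0 : 0 ≤ z * μ := mul_nonneg hz.le (Zd.connectiveConstant_nonneg (d + 1))
    have hδ : 0 < 1 - E * (1 - z * μ) / z := by
      rw [sub_pos, div_lt_one hz]; exact h2
    obtain ⟨M, hM⟩ := exists_pow_lt_of_lt_one hδ h1
    refine ⟨M, ?_⟩
    have h1' : 0 < 1 - z * μ := sub_pos.2 h1
    have hne : z * μ - 1 ≠ 0 := by linarith
    have hgeom : ∑ n ∈ Finset.range (M + 1), (z * μ) ^ n = (1 - (z * μ) ^ (M + 1)) / (1 - z * μ) := by
      rw [geom_sum_eq (ne_of_lt h1)]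
      rw [div_eq_div_iff hne h1'.ne']
      ring
    have hpowle : (z * μ) ^ (M + 1) ≤ (z * μ) ^ M := pow_le_pow_of_le_one hzμ0 h1.le (Nat.le_succ M)
    have key : E * (1 - z * μ) < z * (1 - (z * μ) ^ (M + 1)) := by
      have h3 : E * (1 - z * μ) / z < 1 - (z * μ) ^ (M + 1) := by linarith
      rw [div_lt_iff₀ hz] at h3
      linarith
    rw [hgeom, mul_div_assoc', lt_div_iff₀ h1']
    exact key


/-- GOOD SPANS WITH A LINEAR LENGTH CUT-OFF: for `0 < z`, `zμ < 1` and `1/(e^ε-1) < ½ log(z/(1-zμ))`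
there are `A ≥ 1` and `M₁` with `e^{-εkA} < V_{kM₁}(z; kA)` for every `k ≥ 1`. 
[cite: MadrasSlade1993, §3.1, Corollary 3.1.8 p. 61 and (3.1.13) (bridges by span; pigeonhole over the spans)] -/
theorem exists_goodSpan_linear (d : ℕ) {z ε : ℝ} (hz : 0 < z) (hzμ : z * Zd.connectiveConstant (d + 1) < 1)
    (hε : 0 < ε) (h : 1 / (Real.exp ε - 1) < Real.log (z / (1 - z * Zd.connectiveConstant (d + 1))) / 2) :
    ∃ A : ℕ, 1 ≤ A ∧ ∃ M₁ : ℕ, ∀ k : ℕ, 1 ≤ k →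
      Real.exp (-(ε * (k * A))) < Zd.brGF (d + 1) (k * M₁) z ((k * A : ℕ) : ℤ) := by
  set μ := Zd.connectiveConstant (d + 1) with hμ
  have h1' : 0 < 1 - z * μ := by linarith
  have hq : 0 < z / (1 - z * μ) := div_pos hz h1'
  set E := Real.exp (2 / (Real.exp ε - 1)) with hE
  have hE0 : 0 < E := Real.exp_pos _
  have hEz : E * (1 - z * μ) < z := by
    have hlt : E < z / (1 - z * μ) := by
      rw [hE, ← Real.exp_log hq]
      have h2t : 2 / (Real.exp ε - 1) = 2 * (1 / (Real.exp ε - 1)) := by ring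
      exact Real.exp_lt_exp.2 (by rw [h2t]; linarith)
    rwa [lt_div_iff₀ h1'] at hlt
  obtain ⟨M, hM⟩ := exists_lt_mul_geom_sum d hz hE0 (Or.inr ⟨hzμ, hEz⟩)
  have hB := Zd.half_log_geom_le_bridgeGFpos d M hz
  have hlog : 2 / (Real.exp ε - 1) <
      Real.log (z * ∑ n ∈ Finset.range (M + 1), (z * Zd.connectiveConstant (d + 1)) ^ n) := by
    have := Real.log_lt_log hE0 hM
    rwa [hE, Real.log_exp] at this
  have hB' : 1 / (Real.exp ε - 1) < Zd.bridgeGFpos (d + 1) (M + 1) z := by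
    have h2 : 1 / (Real.exp ε - 1) = (2 / (Real.exp ε - 1)) / 2 := by ring
    rw [h2]
    linarith
  obtain ⟨A, hA1, -, hA⟩ := Zd.exists_span_lt_brGF d (M + 1) hz.le hε hB'
  refine ⟨A, hA1, M + 1, fun k hk => ?_⟩
  have hpow := Zd.brGF_pow_le (d := d + 1) (M + 1) hz.le (A : ℤ) k
  have hcast : ((k * A : ℕ) : ℤ) = (k : ℤ) * (A : ℤ) := by push_cast; ring
  rw [hcast]
  have he0 : 0 < Real.exp (-(ε * A)) := Real.exp_pos _
  have hek : Real.exp (-(ε * ((k : ℝ) * (A : ℝ)))) = Real.exp (-(ε * A)) ^ k := by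
    rw [← Real.exp_nat_mul]
    congr 1
    ring
  calc Real.exp (-(ε * ((k : ℝ) * (A : ℝ)))) = Real.exp (-(ε * A)) ^ k := hek
    _ < Zd.brGF (d + 1) (M + 1) z (A : ℤ) ^ k := pow_lt_pow_left₀ hA he0.le (by omega)
    _ ≤ Zd.brGF (d + 1) (k * (M + 1)) z ((k : ℤ) * (A : ℤ)) := hpow


/-- `#{ω ∈ saws : ω n = a e₁} = c_n(a e₁)`. 
[cite: MadrasSlade1993, §1.3 (the two-point count c_N(0,x))] -/
theorem card_filter_axisPoint_eq_countAt (d n : ℕ) (a : ℤ) :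
    ((Zd.saws (d + 1) n).filter fun ω => ω n = Zd.axisPoint (d + 1) a).card =
      Zd.countAt (d + 1) n (Zd.axisPoint (d + 1) a) := by
  classical
  rw [← Zd.card_sawFun]
  congr 1
  ext ω
  rw [Finset.mem_filter, Zd.mem_sawFun_iff_mem_saws]


/-- Linear-vs-logarithmic comparison (real analysis; `log u ≤ u - 1` at the scale `η`, then Archimedes). If for every `k ≥ 1`
`e^{-2εkA} < C (kM₁+1)(2kM₁+1)^d e^{-m(2kA+1)}` with `A ≥ 1`, then `m ≤ ε`. 
[folklore] -/
private theorem le_of_exp_lt_poly_mul_exp {ε m C : ℝ} {d A M₁ : ℕ} (hA : 1 ≤ A) (hC : 0 < C)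
    (h : ∀ k : ℕ, 1 ≤ k → Real.exp (-(2 * ε * (k * A))) <
      C * (((k * M₁ + 1 : ℕ) : ℝ) * ((2 * (k * M₁) + 1 : ℕ) : ℝ) ^ d) *
        Real.exp (-(m * ((2 * (k * A) + 1 : ℕ) : ℝ)))) :
    m ≤ ε := by
  by_contra hlt
  rw [not_le] at hlt
  have hδ0 : 0 < m - ε := by linarith
  have hA0 : (0 : ℝ) < A := by exact_mod_cast hA
  have hM0 : (0 : ℝ) ≤ M₁ := Nat.cast_nonneg _
  have hd0 : (0 : ℝ) ≤ d := Nat.cast_nonneg _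
  -- the linearisation scale `η` and the constant `K`
  obtain ⟨η, hη⟩ : ∃ η : ℝ, η = A * (m - ε) / (2 * (d + 1) * (M₁ + 1)) := ⟨_, rfl⟩
  have hη0 : 0 < η := by rw [hη]; positivity
  have hηM : 2 * (d + 1 : ℝ) * η * M₁ ≤ A * (m - ε) := by
    have hfrac : (M₁ : ℝ) / (M₁ + 1) ≤ 1 := by
      rw [div_le_one (by positivity)]; linarith
    have hAd : 0 ≤ (A : ℝ) * (m - ε) := by positivity
    calc 2 * (d + 1 : ℝ) * η * M₁ = A * (m - ε) * ((M₁ : ℝ) / (M₁ + 1)) := by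
          rw [hη]; field_simp
      _ ≤ A * (m - ε) * 1 := by gcongr
      _ = A * (m - ε) := mul_one _
  obtain ⟨K, hK⟩ : ∃ K : ℝ, K = Real.log C + (d + 1) * (η - 1 - Real.log η) := ⟨_, rfl⟩
  -- main estimate: `k·A·(m-ε) + m < K` for every `k ≥ 1`
  have main : ∀ k : ℕ, 1 ≤ k → (k : ℝ) * A * (m - ε) + m < K := by
    intro k hk1
    have hk := h k hk1
    have hk0 : (0 : ℝ) ≤ k := Nat.cast_nonneg _
    set y : ℝ := ((2 * (k * M₁) + 1 : ℕ) : ℝ) with hy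
    have hy1 : 1 ≤ y := by rw [hy]; exact_mod_cast (by omega : 1 ≤ 2 * (k * M₁) + 1)
    have hy0 : 0 < y := by linarith
    have hP1 : (1 : ℝ) ≤ ((k * M₁ + 1 : ℕ) : ℝ) := by exact_mod_cast (by omega : 1 ≤ k * M₁ + 1)
    have hPpos : 0 < ((k * M₁ + 1 : ℕ) : ℝ) * y ^ d := by positivity
    have hlog := Real.log_lt_log (Real.exp_pos _) hk
    rw [Real.log_exp, Real.log_mul (mul_pos hC hPpos).ne' (Real.exp_pos _).ne',
      Real.log_mul hC.ne' hPpos.ne', Real.log_exp] at hlog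
    have hPle : ((k * M₁ + 1 : ℕ) : ℝ) * y ^ d ≤ y ^ (d + 1) := by
      rw [pow_succ, mul_comm (y ^ d)]
      refine mul_le_mul_of_nonneg_right ?_ (by positivity)
      rw [hy]; exact_mod_cast (by omega : k * M₁ + 1 ≤ 2 * (k * M₁) + 1)
    have hlogP : Real.log (((k * M₁ + 1 : ℕ) : ℝ) * y ^ d) ≤ (d + 1 : ℝ) * (η * y - 1 - Real.log η) := by
      calc Real.log (((k * M₁ + 1 : ℕ) : ℝ) * y ^ d) ≤ Real.log (y ^ (d + 1)) :=
            Real.log_le_log hPpos hPle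
        _ = (d + 1 : ℝ) * Real.log y := by rw [Real.log_pow]; push_cast; ring
        _ ≤ (d + 1 : ℝ) * (η * y - 1 - Real.log η) := by
            refine mul_le_mul_of_nonneg_left ?_ (by positivity)
            have := Real.log_le_sub_one_of_pos (mul_pos hη0 hy0)
            rw [Real.log_mul hη0.ne' hy0.ne'] at this
            linarith
    have hcast1 : ((2 * (k * A) + 1 : ℕ) : ℝ) = 2 * (k : ℝ) * A + 1 := by push_cast; ring
    have hyk : y = 2 * (k : ℝ) * M₁ + 1 := by rw [hy]; push_cast; ring
    rw [hcast1] at hlog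
    have hηy : η * y = 2 * (η * M₁ * k) + η := by rw [hyk]; ring
    have hdηy : (d : ℝ) * (η * y) = 2 * (d * (η * M₁ * k)) + d * η := by rw [hηy]; ring
    have hbd : 2 * (d + 1 : ℝ) * η * M₁ * k ≤ A * (m - ε) * k := mul_le_mul_of_nonneg_right hηM hk0
    rw [hK]
    nlinarith [hlog, hlogP, hηy, hdηy, hbd]
  -- Archimedean contradiction
  have hAd : 0 < (A : ℝ) * (m - ε) := by positivity
  obtain ⟨k₀, hk₀⟩ := exists_nat_gt ((K - m) / (A * (m - ε)))
  have hm := main (k₀ + 1) (by omega)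
  rw [div_lt_iff₀ hAd] at hk₀
  push_cast at hm
  nlinarith [hm, hk₀, hAd]


/-- THE CHAIN, conditional on the reflection bound `hrefl`: for `0 < z < z_c` and all `M, L`,
`V_M(z;L)² ≤ (M+1)(2M+1)^d z⁻¹ · B(z) e^{-m(z)(2L+1)}` (Cauchy–Schwarz over lengths, the reflection
lemma termwise, odd partial sums of `G_z(0,(2L+1)e₁)`, M–S Thm 4.1.3(a) `(4.1.4)` in-tree). 
[cite: MadrasSlade1993, Theorem 4.1.3(a), eq. (4.1.4) pp. 78–80 (G_z(0,x) ≤ B e^{-m(z)|x|}); §3.1 (reflection)] -/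
theorem brGF_sq_le_of_reflectionBound (d M L : ℕ) {z : ℝ} (hz : 0 < z) (hzc : z < Zd.criticalPoint (d + 1))
    (hrefl : ∀ N L : ℕ, ((Zd.brSpan (d + 1) N (L : ℤ)).card : ℝ) ^ 2 ≤ ((2 * N + 1 : ℕ) : ℝ) ^ d *
      (((Zd.saws (d + 1) (2 * N + 1)).filter fun ω =>
          ω (2 * N + 1) = Zd.axisPoint (d + 1) ((2 * L + 1 : ℕ) : ℤ)).card : ℝ)) :
    Zd.brGF (d + 1) M z (L : ℤ) ^ 2 ≤ ((M + 1 : ℕ) : ℝ) * ((2 * M + 1 : ℕ) : ℝ) ^ d * z⁻¹ *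
      (Zd.bubble (d + 1) z * Real.exp (-(Zd.mass (d + 1) z * ((2 * L + 1 : ℕ) : ℝ)))) := by
  classical
  set x := Zd.axisPoint (d + 1) ((2 * L + 1 : ℕ) : ℤ) with hx
  have h413 := (Zd.MadrasSlade1993_thm_4_1_3a_holds (d + 1) (by omega) z hz hzc).2.2 (2 * L + 1)
    (by omega)
  have hG := Zd.hasSum_countAt_mul_pow (d := d + 1) hz hzc x
  have hCS : Zd.brGF (d + 1) M z (L : ℤ) ^ 2 ≤ ((M + 1 : ℕ) : ℝ) *
      ∑ n ∈ Finset.range (M + 1), (((Zd.brSpan (d + 1) n (L : ℤ)).card : ℝ) * z ^ n) ^ 2 := by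
    have := sq_sum_le_card_mul_sum_sq (s := Finset.range (M + 1))
      (f := fun n => ((Zd.brSpan (d + 1) n (L : ℤ)).card : ℝ) * z ^ n)
    rw [Finset.card_range] at this
    rw [Zd.brGF]
    exact_mod_cast this
  have hterm : ∀ n ∈ Finset.range (M + 1),
      (((Zd.brSpan (d + 1) n (L : ℤ)).card : ℝ) * z ^ n) ^ 2 ≤
        ((2 * M + 1 : ℕ) : ℝ) ^ d * z⁻¹ * ((Zd.countAt (d + 1) (2 * n + 1) x : ℝ) * z ^ (2 * n + 1)) := by
    intro n hn
    have hnM : n ≤ M := by rw [Finset.mem_range] at hn; omega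
    have h1 := hrefl n L
    rw [card_filter_axisPoint_eq_countAt] at h1
    have hpow : ((2 * n + 1 : ℕ) : ℝ) ^ d ≤ ((2 * M + 1 : ℕ) : ℝ) ^ d := by
      have hle : ((2 * n + 1 : ℕ) : ℝ) ≤ ((2 * M + 1 : ℕ) : ℝ) := by exact_mod_cast (by omega : 2 * n + 1 ≤ 2 * M + 1)
      exact pow_le_pow_left₀ (by positivity) hle d
    have hz2 : z ^ (2 * n + 1) = z * (z ^ n) ^ 2 := by ring
    rw [mul_pow, hz2]
    have hzi : z⁻¹ * ((Zd.countAt (d + 1) (2 * n + 1) x : ℝ) * (z * (z ^ n) ^ 2)) =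
        (Zd.countAt (d + 1) (2 * n + 1) x : ℝ) * (z ^ n) ^ 2 := by
      field_simp
    calc ((Zd.brSpan (d + 1) n (L : ℤ)).card : ℝ) ^ 2 * (z ^ n) ^ 2
        ≤ ((2 * n + 1 : ℕ) : ℝ) ^ d * (Zd.countAt (d + 1) (2 * n + 1) x : ℝ) * (z ^ n) ^ 2 :=
          mul_le_mul_of_nonneg_right h1 (by positivity)
      _ ≤ ((2 * M + 1 : ℕ) : ℝ) ^ d * (Zd.countAt (d + 1) (2 * n + 1) x : ℝ) * (z ^ n) ^ 2 := by
          gcongr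
      _ = ((2 * M + 1 : ℕ) : ℝ) ^ d * z⁻¹ *
            ((Zd.countAt (d + 1) (2 * n + 1) x : ℝ) * (z * (z ^ n) ^ 2)) := by
          field_simp
  have hsum : ∑ n ∈ Finset.range (M + 1), (Zd.countAt (d + 1) (2 * n + 1) x : ℝ) * z ^ (2 * n + 1) ≤
      Zd.twoPoint (d + 1) 1 z x := by
    have hinj : Set.InjOn (fun n : ℕ => 2 * n + 1) ↑(Finset.range (M + 1)) := by
      intro a _ b _ h
      simp only at h
      omega
    have := sum_le_hasSum ((Finset.range (M + 1)).image fun n : ℕ => 2 * n + 1)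
      (f := fun m : ℕ => (Zd.countAt (d + 1) m x : ℝ) * z ^ m) (fun m _ => by positivity) hG
    rwa [Finset.sum_image hinj] at this
  have hfac : 0 ≤ ((M + 1 : ℕ) : ℝ) * ((2 * M + 1 : ℕ) : ℝ) ^ d * z⁻¹ := by positivity
  calc Zd.brGF (d + 1) M z (L : ℤ) ^ 2
      ≤ ((M + 1 : ℕ) : ℝ) * ∑ n ∈ Finset.range (M + 1),
          (((Zd.brSpan (d + 1) n (L : ℤ)).card : ℝ) * z ^ n) ^ 2 := hCS
    _ ≤ ((M + 1 : ℕ) : ℝ) * ∑ n ∈ Finset.range (M + 1),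
          ((2 * M + 1 : ℕ) : ℝ) ^ d * z⁻¹ * ((Zd.countAt (d + 1) (2 * n + 1) x : ℝ) * z ^ (2 * n + 1)) := by
        gcongr with n hn
        exact hterm n hn
    _ = ((M + 1 : ℕ) : ℝ) * ((2 * M + 1 : ℕ) : ℝ) ^ d * z⁻¹ *
          ∑ n ∈ Finset.range (M + 1), (Zd.countAt (d + 1) (2 * n + 1) x : ℝ) * z ^ (2 * n + 1) := by
        rw [← Finset.mul_sum]; ring
    _ ≤ ((M + 1 : ℕ) : ℝ) * ((2 * M + 1 : ℕ) : ℝ) ^ d * z⁻¹ * Zd.twoPoint (d + 1) 1 z x :=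
        mul_le_mul_of_nonneg_left hsum hfac
    _ ≤ ((M + 1 : ℕ) : ℝ) * ((2 * M + 1 : ℕ) : ℝ) ^ d * z⁻¹ *
          (Zd.bubble (d + 1) z * Real.exp (-(Zd.mass (d + 1) z * ((2 * L + 1 : ℕ) : ℝ)))) :=
        mul_le_mul_of_nonneg_left h413 hfac


/-- **EXPLICIT FORM OF [MadrasSlade1993, Cor. 4.1.15]** (conditional on the reflection bound `hrefl`,
route R29.2): for `0 < z < z_c` with `q := z/(1 - zμ) > 1`, `m(z) ≤ log(1 + 2/log q)`; hence
`m(z) ≤ (2 + o(1))/log(1/(1 - z/z_c))` as `z ↑ z_c`, in every dimension.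
[cite: MadrasSlade1993, Corollary 4.1.15 (p. 86) (explicit rate: not located in print — derived)] -/
theorem mass_le_log_of_reflectionBound (d : ℕ) {z : ℝ} (hz : 0 < z) (hzc : z < Zd.criticalPoint (d + 1))
    (hz1 : 1 < z / (1 - z * Zd.connectiveConstant (d + 1)))
    (hrefl : ∀ N L : ℕ, ((Zd.brSpan (d + 1) N (L : ℤ)).card : ℝ) ^ 2 ≤ ((2 * N + 1 : ℕ) : ℝ) ^ d *
      (((Zd.saws (d + 1) (2 * N + 1)).filter fun ω =>
          ω (2 * N + 1) = Zd.axisPoint (d + 1) ((2 * L + 1 : ℕ) : ℤ)).card : ℝ)) :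
    Zd.mass (d + 1) z ≤ Real.log (1 + 2 / Real.log (z / (1 - z * Zd.connectiveConstant (d + 1)))) := by
  set μ := Zd.connectiveConstant (d + 1) with hμdef
  set q := z / (1 - z * μ) with hqdef
  have hμ : 0 < μ := Zd.connectiveConstant_pos (d + 1)
  have hzμ : z * μ < 1 := by
    have := mul_lt_mul_of_pos_right hzc hμ
    rwa [Zd.criticalPoint, inv_mul_cancel₀ hμ.ne'] at this
  have hlogq : 0 < Real.log q := Real.log_pos hz1
  have h2q : 0 < 2 / Real.log q := by positivity
  refine le_of_forall_gt_imp_ge_of_dense fun ε hε => ?_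
  have hε0 : 0 < ε := lt_trans (Real.log_pos (by linarith)) hε
  have hthr : 1 / (Real.exp ε - 1) < Real.log q / 2 := by
    have h1 : 1 + 2 / Real.log q < Real.exp ε := by
      have := Real.exp_lt_exp.2 hε
      rwa [Real.exp_log (by linarith)] at this
    have h2 : 0 < Real.exp ε - 1 := by linarith
    have h3 : 2 / Real.log q < Real.exp ε - 1 := by linarith
    rw [div_lt_iff₀ hlogq] at h3
    rw [div_lt_div_iff₀ h2 two_pos]
    linarith
  obtain ⟨A, hA1, M₁, hk⟩ := exists_goodSpan_linear d hz hzμ hε0 hthr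
  have hB0 : 0 ≤ Zd.bubble (d + 1) z := Zd.bubble_nonneg (d + 1) z
  have hC : 0 < z⁻¹ * (Zd.bubble (d + 1) z + 1) := by positivity
  refine le_of_exp_lt_poly_mul_exp (d := d) (A := A) (M₁ := M₁) hA1 hC fun k hk1 => ?_
  have hV := hk k hk1
  have hVpos : 0 < Zd.brGF (d + 1) (k * M₁) z ((k * A : ℕ) : ℤ) := (Real.exp_pos _).trans hV
  have hsq : Real.exp (-(2 * ε * (k * A))) < Zd.brGF (d + 1) (k * M₁) z ((k * A : ℕ) : ℤ) ^ 2 := by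
    have he : Real.exp (-(2 * ε * (k * A))) = Real.exp (-(ε * (k * A))) ^ 2 := by
      rw [sq, ← Real.exp_add]; ring_nf
    rw [he]
    exact pow_lt_pow_left₀ hV (Real.exp_pos _).le two_ne_zero
  have hch := brGF_sq_le_of_reflectionBound d (k * M₁) (k * A) hz hzc hrefl
  refine hsq.trans_le (hch.trans ?_)
  have hE : 0 ≤ Real.exp (-(Zd.mass (d + 1) z * ((2 * (k * A) + 1 : ℕ) : ℝ))) := (Real.exp_pos _).le
  have hP : 0 ≤ ((k * M₁ + 1 : ℕ) : ℝ) * ((2 * (k * M₁) + 1 : ℕ) : ℝ) ^ d := by positivity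
  calc ((k * M₁ + 1 : ℕ) : ℝ) * ((2 * (k * M₁) + 1 : ℕ) : ℝ) ^ d * z⁻¹ *
        (Zd.bubble (d + 1) z * Real.exp (-(Zd.mass (d + 1) z * ((2 * (k * A) + 1 : ℕ) : ℝ))))
      ≤ ((k * M₁ + 1 : ℕ) : ℝ) * ((2 * (k * M₁) + 1 : ℕ) : ℝ) ^ d * z⁻¹ *
        ((Zd.bubble (d + 1) z + 1) * Real.exp (-(Zd.mass (d + 1) z * ((2 * (k * A) + 1 : ℕ) : ℝ)))) := by
        gcongr; linarith
    _ = z⁻¹ * (Zd.bubble (d + 1) z + 1) * (((k * M₁ + 1 : ℕ) : ℝ) * ((2 * (k * M₁) + 1 : ℕ) : ℝ) ^ d) *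
        Real.exp (-(Zd.mass (d + 1) z * ((2 * (k * A) + 1 : ℕ) : ℝ))) := by ring



/-- **EXPLICIT FORM OF [MadrasSlade1993, Cor. 4.1.15], unconditional** (every `d`; walks on `ℤ^{d+1}`):
for `0 < z < z_c = μ⁻¹` with `z/(1 - zμ) > 1`,  `m(z) ≤ log(1 + 2/log(z/(1 - zμ)))`.
[cite: MadrasSlade1993, Corollary 4.1.15 (p. 86) (explicit rate: not located in print — derived)] -/
theorem mass_le_log_one_add_two_div_log (d : ℕ) {z : ℝ} (hz : 0 < z)
    (hzc : z < Zd.criticalPoint (d + 1)) (hz1 : 1 < z / (1 - z * Zd.connectiveConstant (d + 1))) :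
    Zd.mass (d + 1) z ≤ Real.log (1 + 2 / Real.log (z / (1 - z * Zd.connectiveConstant (d + 1)))) :=
  mass_le_log_of_reflectionBound d hz hzc hz1 fun N L => card_brSpan_sq_le_real N L

end Literature.Probability.RandomPlanarGeometry.SAW.Zd
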